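import Literature.AlgebraicGeometry.HodgeTheory.HodgeIndexTheoremLatticeSignature
import Literature.AlgebraicGeometry.HodgeTheory.EulerCharacteristicHodgeNumbers
import Literature.AlgebraicGeometry.HodgeTheory.AbelianVarietyHodgeNumbers
import HarnessLib

/-!
# Validation instance: the signature and the Euler characteristic of an abelian variety vanish

Family `hodge`, layer `Literature/AlgebraicGeometry/HodgeTheory`. Theorems only (no definition, no
named fact; D-0026). A sanity instance of the lane's Hodge-number bookkeeping on the Betti carrier
`A(ℂ)` of a complex abelian variety `A` of dimension `g` (Layer A validation, "dimension counts"):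
with the Hodge numbers `h^{p,q}(A) = C(g, p) C(g, q)` (Birkenhake–Lange / Lange, *Abelian Varieties
over the Complex Numbers* (2023), §1.1.5 Thm. 1.1.21; the tree's
`HodgeModel.finrank_typePiece_eq_choose_mul_choose`) and `Σ_{a ≤ g} (-1)^a C(g, a) = 0` for `g ≥ 1`
(Mathlib `Int.alternating_sum_range_choose_of_ne`),

* `AbelianVariety.eulerChar_complexPoints_eq_zero` — **`E(A(ℂ)) = Σ_{i ≤ 2g} (-1)^i rank_ℤ H_i(A(ℂ); ℤ) = 0`**
  for `g ≥ 1`, from Hirzebruch's Thm. 15.8.1 `E = Σ_{p,q} (-1)^{p+q} h^{p,q}`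
  (`HodgeModel.eulerChar_eq_sum_sum_neg_one_pow_hodgeNumber`):
  `Σ_{p,q} (-1)^{p+q} C(g,p) C(g,q) = (Σ_p (-1)^p C(g,p))² = 0`;
* `AbelianVariety.signature_intersectionForm_eq_zero` — **`τ(A(ℂ)) = 0`** for `g = 2m ≥ 2` and every
  `ℤ`-orientation of the closed `4m`-manifold `A(ℂ)`, from the Hodge index theorem on the intersection
  lattice `τ = ε Σ_{a,b} (-1)^a h^{a,b}` (`hodgeIndex_intersectionForm_signature`, Hirzebruch
  Thm. 15.8.2 / Voisin I Thm. 6.33): `Σ_{a,b} (-1)^a C(g,a) C(g,b) = (Σ_a (-1)^a C(g,a)) · 2^g = 0`.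

(The torus-carrier statement `signature = 0` for complex tori is
`Geometry/Kaehler/ComplexTorusSingularIntersectionFormSignature`; here the carrier is the Betti
cohomology of the algebraic variety and the route is the Hodge index theorem.)

## References

* [Lange2023AbelianVarietiesComplex] H. Lange, Abelian Varieties over the Complex Numbers (2023),
  §1.1.5 Thm. 1.1.21 (PDF p. 25).
* [Hirzebruch1966] F. Hirzebruch, Topological Methods in Algebraic Geometry (1966), §15.8
  Thms. 15.8.1–15.8.2.
* [VoisinHodgeI2002] C. Voisin, Hodge Theory and Complex Algebraic Geometry I (2002), §6.3.2 Thm. 6.33.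
-/

noncomputable section

open scoped Manifold ContDiff
open CategoryTheory AlgebraicGeometry Module Bundle Finset
open Literature.AlgebraicTopology.SingularHomology Literature.Geometry.Kaehler
open Literature.NumberTheory.Transcendental
open Literature.AlgebraicGeometry.Motives (AbelianVariety ComplexPoints IsSmoothProjective)

namespace Literature.AlgebraicGeometry.HodgeTheory

section AbelianVarietyValidation

/-- The Hodge numbers of an abelian variety read on a Hodge model over ANY spelling `n` of its
dimension: `dim H^{p,q}_B = C(g, p) C(g, q)`. [cite: Lange2023AbelianVarietiesComplex, §1.1.5 Thm. 1.1.21 (PDF p. 25)] -/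
private theorem finrank_typePiece_eq_choose_mul_choose' (A : AbelianVariety ℂ) {n : ℕ}
    (hn : A.dim = n) (B : HodgeModel n A.X) (k : ℕ) (pq : ↥(Finset.HasAntidiagonal.antidiagonal k)) :
    Module.finrank ℂ (B.typePiece k pq) = A.dim.choose pq.1.1 * A.dim.choose pq.1.2 := by
  subst hn
  exact HodgeModel.finrank_typePiece_eq_choose_mul_choose A B k pq

/-- `h^{p,q}(A) = C(g, p) C(g, q)` in the `hodgePQ (p + q) p q` spelling, cast to `ℤ`.
[cite: Lange2023AbelianVarietiesComplex, §1.1.5 Thm. 1.1.21 (PDF p. 25)] -/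
private theorem cast_finrank_hodgePQ_eq (A : AbelianVariety ℂ) {n : ℕ} (hn : A.dim = n)
    (B : HodgeModel n A.X) (p q : ℕ) :
    (Module.finrank ℂ (B.hodgePQ (p + q) p q) : ℤ) = (A.dim.choose p : ℤ) * (A.dim.choose q : ℤ) := by
  rw [← B.finrank_typePiece_eq_finrank_hodgePQ (Finset.HasAntidiagonal.mem_antidiagonal.2 rfl),
    finrank_typePiece_eq_choose_mul_choose' A hn B]
  push_cast
  rfl

/-- **The Euler–Poincaré characteristic of a complex abelian variety vanishes**:
`Σ_{i ≤ 2g} (-1)^i rank_ℤ H_i(A(ℂ); ℤ) = 0` for `g = dim A ≥ 1` — Hirzebruch's Thm. 15.8.1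
`E = Σ_{p,q} (-1)^{p+q} h^{p,q}` with `h^{p,q}(A) = C(g,p) C(g,q)` and `Σ_p (-1)^p C(g,p) = 0`.
[cite: Hirzebruch1966, §15.8 Thm. 15.8.1] [cite: Lange2023AbelianVarietiesComplex, §1.1.5 Thm. 1.1.21 (PDF p. 25)] -/
theorem AbelianVariety.eulerChar_complexPoints_eq_zero (A : AbelianVariety ℂ) (hA : A.dim ≠ 0) :
    ∑ i ∈ range (2 * A.dim + 1),
        (-1 : ℤ) ^ i * (Module.finrank ℤ (singularHomology ℤ ℤ (ComplexPoints A.X) i) : ℤ) = 0 := by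
  have hX : IsSmoothProjective A.dim A.X := Motives.AbelianVariety.isSmoothProjective_holds
  obtain ⟨B⟩ := nonempty_hodgeModel_holds (n := A.dim) (X := A.X) hX
  rw [B.eulerChar_eq_sum_sum_neg_one_pow_hodgeNumber hX]
  simp_rw [cast_finrank_hodgePQ_eq A rfl B]
  rw [Fin.sum_univ_eq_sum_range (fun p ↦ ∑ q : Fin (A.dim + 1),
    (-1 : ℤ) ^ (p + (q : ℕ)) * ((A.dim.choose p : ℤ) * (A.dim.choose (q : ℕ) : ℤ))) (A.dim + 1)]
  have hinner : ∀ p : ℕ, (∑ q : Fin (A.dim + 1),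
      (-1 : ℤ) ^ (p + (q : ℕ)) * ((A.dim.choose p : ℤ) * (A.dim.choose (q : ℕ) : ℤ))) =
        (-1 : ℤ) ^ p * (A.dim.choose p : ℤ) *
          ∑ q ∈ range (A.dim + 1), (-1 : ℤ) ^ q * (A.dim.choose q : ℤ) := by
    intro p
    rw [Fin.sum_univ_eq_sum_range (fun q ↦
      (-1 : ℤ) ^ (p + q) * ((A.dim.choose p : ℤ) * (A.dim.choose q : ℤ))) (A.dim + 1), Finset.mul_sum]
    exact Finset.sum_congr rfl fun q _ ↦ by ring
  simp_rw [hinner]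
  rw [Int.alternating_sum_range_choose_of_ne hA]
  simp

/-- **The signature of an even-dimensional complex abelian variety vanishes**: for `dim A = 2m ≥ 2`
and every `ℤ`-orientation `μ` of the closed `4m`-manifold `A(ℂ)`, the integral intersection form on
`H^{2m}(A(ℂ); ℤ)/T` has signature `0` — the Hodge index theorem `τ = ε Σ_{a,b} (-1)^a h^{a,b}`
(`hodgeIndex_intersectionForm_signature`) with `h^{a,b}(A) = C(g,a) C(g,b)` and `Σ_a (-1)^a C(g,a) = 0`.
[cite: Hirzebruch1966, §15.8 Thm. 15.8.2] [cite: VoisinHodgeI2002, §6.3.2 Thm. 6.33]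
[cite: Lange2023AbelianVarietiesComplex, §1.1.5 Thm. 1.1.21 (PDF p. 25)] -/
theorem AbelianVariety.signature_intersectionForm_eq_zero (A : AbelianVariety ℂ) {m N : ℕ}
    (hm : A.dim = 2 * m) (hm0 : m ≠ 0) (hN : 2 * (2 * m) = N)
    (μ : HomologicalOrientation ℤ (ComplexPoints A.X) N) (hdeg : 2 * m + 2 * m = N) :
    (intersectionForm hdeg μ).signature = 0 := by
  have hX : IsSmoothProjective (2 * m) A.X := hm ▸ Motives.AbelianVariety.isSmoothProjective_holds
  obtain ⟨ε, -, h⟩ := hodgeIndex_intersectionForm_signature hX hN μ hdeg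
  obtain ⟨B⟩ := nonempty_hodgeModel_holds (n := 2 * m) (X := A.X) hX
  rw [h B]
  simp_rw [cast_finrank_hodgePQ_eq A hm B, hm]
  rw [Fin.sum_univ_eq_sum_range (fun a ↦ ∑ b : Fin (2 * m + 1),
    (-1 : ℤ) ^ a * (((2 * m).choose a : ℤ) * ((2 * m).choose (b : ℕ) : ℤ))) (2 * m + 1)]
  have hinner : ∀ a : ℕ, (∑ b : Fin (2 * m + 1),
      (-1 : ℤ) ^ a * (((2 * m).choose a : ℤ) * ((2 * m).choose (b : ℕ) : ℤ))) =
        (-1 : ℤ) ^ a * ((2 * m).choose a : ℤ) *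
          ∑ b ∈ range (2 * m + 1), ((2 * m).choose b : ℤ) := by
    intro a
    rw [Fin.sum_univ_eq_sum_range (fun b ↦
      (-1 : ℤ) ^ a * (((2 * m).choose a : ℤ) * ((2 * m).choose b : ℤ))) (2 * m + 1), Finset.mul_sum]
    exact Finset.sum_congr rfl fun b _ ↦ by ring
  simp_rw [hinner]
  rw [← Finset.sum_mul, Int.alternating_sum_range_choose_of_ne (by omega : 2 * m ≠ 0), zero_mul,
    mul_zero]

end AbelianVarietyValidation

end Literature.AlgebraicGeometry.HodgeTheory

end
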